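import Mathlib.Analysis.Distribution.Sobolev
import HarnessLib

-- provenance: harness21/H21/H21/Prelude/Sobolev/BesselSobolevSpace.lean @ ad337f9 (interim HEAD d8f2665); M5 mechanical rewrite
/-!
# Bundled Bessel-potential (Sobolev) spaces `H^{s,p}(E; F)`

Trunk: Sobolev (outline `H21/Outlines/Sobolev.md`, item C6; notion `sobolev_Hsp_bessel_Rn`,
part 1).

Mathlib (`Mathlib/Analysis/Distribution/Sobolev.lean`) provides the *predicate*
`TemperedDistribution.MemSobolev s p f` ("the tempered distribution `f` lies in `H^{s,p}`"),
defined as `∃ f' : Lp F p volume, besselPotential E F s f = f'`, together with the Bessel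
potential operator `TemperedDistribution.besselPotential E F s : 𝓢'(E, F) →L[ℂ] 𝓢'(E, F)`
(the Fourier multiplier with symbol `⟨ξ⟩^s = (1 + ‖ξ‖²)^{s/2}`). It does not provide a bundled
Banach space `H^{s,p}`. This file supplies one.

## Design

Following outline decision D1, the carrier of `Literature.BesselSobolev E F s p` is a *type synonym* of
`Lp F p (volume : Measure E)`: an element `u ∈ H^{s,p}` is *stored* as its Bessel potential
`J_s u = ⟨D⟩^s u ∈ L^p`, so that the norm `‖u‖_{H^{s,p}} := ‖J_s u‖_{L^p}` is the `L^p` norm of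
the stored function *by definition*, and all the analytic structure (`NormedAddCommGroup`,
`NormedSpace ℂ`, `CompleteSpace`, and `InnerProductSpace ℂ` for `p = 2`) is inherited from
Mathlib's `Lp` via `inferInstanceAs`, with no proof obligations. The regularity index `s` is a
**phantom parameter** of the carrier: it only enters through the embedding
`BesselSobolev.toDistrib s p : BesselSobolev E F s p →L[ℂ] 𝓢'(E, F)`, `v ↦ J_{-s} v`, whose
range is exactly `{f | MemSobolev s p f}` (`BesselSobolev.mem_range_toDistrib_iff`).

## Main definitions

* `Literature.BesselSobolev E F s p`: the Banach space `H^{s,p}(E; F)`.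
* `Literature.Analysis.FunctionSpaces.BesselSobolev.toDistrib`: the (injective) embedding into tempered distributions.
* `Literature.Analysis.FunctionSpaces.BesselSobolev.ofMemSobolev`: the element of `H^{s,p}` representing a distribution
  satisfying `MemSobolev s p`.
* `Literature.Analysis.FunctionSpaces.BesselSobolev.zeroEquiv`: `H^{0,p} ≃ₗᵢ L^p`.
* `SchwartzMap.toBesselSobolev`: Schwartz functions as elements of `H^{s,p}` (a deliberate
  dot-notation extension of Mathlib's `SchwartzMap` namespace).

## References

* M. Taylor, *Partial Differential Equations I*, 2nd ed. (2011), Ch. 4 §1 and Ch. 13 §6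
  (`H^{s,p} = ⟨D⟩^{-s} L^p`).
* H. Triebel, *Theory of Function Spaces* (1983), §2.3.3 (Bessel-potential spaces).
* W. McLean, *Strongly Elliptic Systems and Boundary Integral Equations* (2000), Ch. 3.
-/

noncomputable section

open MeasureTheory TemperedDistribution ENNReal
open scoped SchwartzMap

namespace Literature.Analysis.FunctionSpaces

variable (E F : Type*) [NormedAddCommGroup E] [InnerProductSpace ℝ E] [FiniteDimensional ℝ E]
  [MeasurableSpace E] [BorelSpace E] [NormedAddCommGroup F] [NormedSpace ℂ F] [CompleteSpace F]

/-- The Bessel-potential (Sobolev) space `H^{s,p}(E; F)` of `F`-valued tempered distributions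
`u` on the finite-dimensional real inner product space `E` with `J_s u = ⟨D⟩^s u ∈ L^p`
(Taylor, *PDE I*, Ch. 13 §6; Triebel 1983, §2.3.3).

Implementation: the carrier is (a type synonym of) `Lp F p volume`; an element `u` is *stored*
as `J_s u ∈ L^p`, so `‖u‖ = ‖J_s u‖_{L^p}` definitionally. The index `s` is a **phantom
parameter** of the carrier — it is only used by the embedding `BesselSobolev.toDistrib`
(`v ↦ J_{-s} v`) into `𝓢'(E, F)`. [cite: Triebel1983, §2.3.3] -/
@[nolint unusedArguments]
def BesselSobolev (_s : ℝ) (p : ℝ≥0∞) : Type _ := Lp F p (volume : Measure E)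

namespace BesselSobolev

variable {E F}
variable (s : ℝ) (p : ℝ≥0∞) [Fact (1 ≤ p)]

/-- `H^{s,p}` is a normed additive commutative group, with the Bessel-potential norm
`‖u‖ = ‖J_s u‖_{L^p}` (Taylor, *PDE I*, Ch. 13 §6). Inherited from `Lp`. [folklore] -/
instance instNormedAddCommGroup : NormedAddCommGroup (BesselSobolev E F s p) :=
  inferInstanceAs (NormedAddCommGroup (Lp F p (volume : Measure E)))

/-- `H^{s,p}` is a complex normed space (Taylor, *PDE I*, Ch. 13 §6). Inherited from `Lp`. [folklore] -/
instance instNormedSpace : NormedSpace ℂ (BesselSobolev E F s p) :=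
  inferInstanceAs (NormedSpace ℂ (Lp F p (volume : Measure E)))

/-- `H^{s,p}` is a Banach space (Taylor, *PDE I*, Ch. 13 §6; Triebel 1983, Thm. 2.3.3).
Inherited from completeness of `Lp`. [cite: Triebel1983, Thm. 2.3.3] -/
instance instCompleteSpace : CompleteSpace (BesselSobolev E F s p) :=
  inferInstanceAs (CompleteSpace (Lp F p (volume : Measure E)))

/-- `H^s = H^{s,2}` is a Hilbert space when `F` is (Taylor, *PDE I*, Ch. 4 §1). Inherited from
`MeasureTheory.L2.innerProductSpace`. [folklore] -/
instance instInnerProductSpace {F : Type*} [NormedAddCommGroup F] [InnerProductSpace ℂ F] :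
    InnerProductSpace ℂ (BesselSobolev E F s 2) :=
  inferInstanceAs (InnerProductSpace ℂ (Lp F 2 (volume : Measure E)))

/-- The stored `L^p` function `J_s u` of an element `u ∈ H^{s,p}` (the identity map on the
carrier; Taylor, *PDE I*, Ch. 13 §6). [folklore] -/
def toLp : BesselSobolev E F s p ≃ₗᵢ[ℂ] Lp F p (volume : Measure E) :=
  LinearIsometryEquiv.refl ℂ _

omit [CompleteSpace F] in
/-- The norm on `H^{s,p}` is the `L^p` norm of the stored Bessel potential `J_s u`
(Taylor, *PDE I*, Ch. 13 §6, definition of `‖·‖_{H^{s,p}}`). [folklore] -/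
theorem norm_def (u : BesselSobolev E F s p) : ‖u‖ = ‖toLp s p u‖ := rfl

/-- The canonical embedding `H^{s,p}(E; F) → 𝓢'(E, F)`, `v ↦ J_{-s} v` where `v ∈ L^p` is the
stored function: it recovers the distribution `u` from `J_s u` (Taylor, *PDE I*, Ch. 13 §6,
`H^{s,p} = ⟨D⟩^{-s} L^p`). [folklore] -/
def toDistrib : BesselSobolev E F s p →L[ℂ] 𝓢'(E, F) :=
  (besselPotential E F (-s)).comp (Lp.toTemperedDistributionCLM F (volume : Measure E) p)

/-- Unfolding of the embedding: `toDistrib s p u = J_{-s} (J_s u)` with `J_s u = toLp s p u`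
the stored `L^p` function (Taylor, *PDE I*, Ch. 13 §6). [folklore] -/
theorem toDistrib_apply (u : BesselSobolev E F s p) :
    toDistrib s p u = besselPotential E F (-s) (Lp.toTemperedDistribution (toLp s p u)) := rfl

/-- Every element of the bundled space `H^{s,p}` defines a distribution in Mathlib's
`MemSobolev s p` (Taylor, *PDE I*, Ch. 13 §6). [folklore] -/
theorem memSobolev_toDistrib (u : BesselSobolev E F s p) : MemSobolev s p (toDistrib s p u) :=
  ⟨toLp s p u, by simp [toDistrib_apply]⟩

/-- The embedding `H^{s,p} → 𝓢'` is injective (Taylor, *PDE I*, Ch. 13 §6): `J_{-s}` is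
invertible with inverse `J_s`, and `L^p → 𝓢'` is injective
(`MeasureTheory.Lp.ker_toTemperedDistributionCLM_eq_bot`). [folklore] -/
theorem toDistrib_injective : Function.Injective (toDistrib (E := E) (F := F) s p) := by
  intro u v huv
  have h : Lp.toTemperedDistributionCLM F (volume : Measure E) p (toLp s p u) =
      Lp.toTemperedDistributionCLM F (volume : Measure E) p (toLp s p v) := by
    have := congrArg (besselPotential E F s) huv
    simpa [toDistrib_apply] using this
  have hker := Lp.ker_toTemperedDistributionCLM_eq_bot (F := F) (μ := (volume : Measure E))
    (p := p)
  rw [LinearMap.ker_eq_bot] at hker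
  exact (toLp s p).injective (hker h)

variable {s p}

/-- The element of `H^{s,p}` representing a tempered distribution `f` with `MemSobolev s p f`,
namely (the stored function) `J_s f ∈ L^p` (Taylor, *PDE I*, Ch. 13 §6). [folklore] -/
def ofMemSobolev {f : 𝓢'(E, F)} (hf : MemSobolev s p f) : BesselSobolev E F s p :=
  (toLp s p).symm hf.choose

/-- `ofMemSobolev hf` represents `f` (Taylor, *PDE I*, Ch. 13 §6). [folklore] -/
@[simp]
theorem toDistrib_ofMemSobolev {f : 𝓢'(E, F)} (hf : MemSobolev s p f) :
    toDistrib s p (ofMemSobolev hf) = f := by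
  rw [toDistrib_apply, besselPotential_neg_apply_eq_iff]
  exact hf.choose_spec

variable (s p) in
/-- The range of the embedding `H^{s,p} → 𝓢'` is exactly Mathlib's Sobolev class
`MemSobolev s p` (Taylor, *PDE I*, Ch. 13 §6). [folklore] -/
theorem mem_range_toDistrib_iff {f : 𝓢'(E, F)} :
    f ∈ Set.range (toDistrib (E := E) (F := F) s p) ↔ MemSobolev s p f := by
  constructor
  · rintro ⟨u, rfl⟩
    exact memSobolev_toDistrib s p u
  · intro hf
    exact ⟨ofMemSobolev hf, toDistrib_ofMemSobolev hf⟩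

/-- `ofMemSobolev` is a left inverse of `toDistrib` (Taylor, *PDE I*, Ch. 13 §6). [folklore] -/
@[simp]
theorem ofMemSobolev_toDistrib (u : BesselSobolev E F s p) :
    ofMemSobolev (memSobolev_toDistrib s p u) = u :=
  toDistrib_injective s p (toDistrib_ofMemSobolev _)

variable (p) in
/-- `H^{0,p} = L^p` isometrically: for `s = 0` the stored function is `u` itself
(Taylor, *PDE I*, Ch. 13 §6). [folklore] -/
def zeroEquiv : BesselSobolev E F 0 p ≃ₗᵢ[ℂ] Lp F p (volume : Measure E) :=
  LinearIsometryEquiv.refl ℂ _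

/-- Under `H^{0,p} = L^p` the embedding into `𝓢'` is the usual embedding of `L^p`
(Taylor, *PDE I*, Ch. 13 §6). [folklore] -/
@[simp]
theorem toDistrib_zeroEquiv (u : BesselSobolev E F 0 p) :
    Lp.toTemperedDistribution (zeroEquiv p u) = toDistrib 0 p u := by
  simp [toDistrib_apply, zeroEquiv, toLp]

end BesselSobolev

end Literature.Analysis.FunctionSpaces

namespace SchwartzMap

open Literature.Analysis.FunctionSpaces

variable {E F : Type*} [NormedAddCommGroup E] [InnerProductSpace ℝ E] [FiniteDimensional ℝ E]
  [MeasurableSpace E] [BorelSpace E] [NormedAddCommGroup F] [NormedSpace ℂ F] [CompleteSpace F]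

/-- A Schwartz function as an element of `H^{s,p}`, for every `s` and `1 ≤ p`
(Taylor, *PDE I*, Ch. 13 §6; Mathlib's `SchwartzMap.memSobolev`). This is a deliberate
dot-notation extension of Mathlib's `SchwartzMap` namespace. [folklore] -/
def toBesselSobolev (s : ℝ) (p : ℝ≥0∞) [Fact (1 ≤ p)] (φ : 𝓢(E, F)) : BesselSobolev E F s p :=
  BesselSobolev.ofMemSobolev φ.memSobolev

end SchwartzMap

namespace Literature.Analysis.FunctionSpaces.BesselSobolev

variable {E F : Type*} [NormedAddCommGroup E] [InnerProductSpace ℝ E] [FiniteDimensional ℝ E]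
  [MeasurableSpace E] [BorelSpace E] [NormedAddCommGroup F] [NormedSpace ℂ F] [CompleteSpace F]

/-- The element `φ.toBesselSobolev s p ∈ H^{s,p}` represents the distribution `φ`
(Taylor, *PDE I*, Ch. 13 §6). [folklore] -/
@[simp]
theorem toDistrib_toBesselSobolev (s : ℝ) (p : ℝ≥0∞) [Fact (1 ≤ p)] (φ : 𝓢(E, F)) :
    toDistrib s p (φ.toBesselSobolev s p) = (φ : 𝓢'(E, F)) :=
  toDistrib_ofMemSobolev _

/-- Monotonicity of the Hilbert Sobolev scale, `H^s ⊆ H^{s'}` for `s' ≤ s`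
(Taylor, *PDE I*, Ch. 4 §1; Mathlib's `MemSobolev.mono`): every `u ∈ H^s` is represented by
some `v ∈ H^{s'}` with the same underlying distribution. (v0: existence only; the continuous
inclusion map is not bundled here.) [folklore] -/
theorem exists_of_le {F : Type*} [NormedAddCommGroup F] [InnerProductSpace ℂ F] [CompleteSpace F]
    {s s' : ℝ} (h : s' ≤ s) (u : BesselSobolev E F s 2) :
    ∃ v : BesselSobolev E F s' 2, toDistrib s' 2 v = toDistrib s 2 u :=
  ⟨ofMemSobolev ((memSobolev_toDistrib s 2 u).mono h), toDistrib_ofMemSobolev _⟩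

end Literature.Analysis.FunctionSpaces.BesselSobolev
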